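import Summits.AtomisticToContinuum.FouriersLaw.Theses.VanishingNoiseTransfer
import Summits.AtomisticToContinuum.FouriersLaw.Theorems.VanishingNoiseTransferNoiseLocalityStubResponseDensityDet
import Summits.AtomisticToContinuum.FouriersLaw.Theorems.VanishingNoiseTransferNoiseLocalityStubResponseDensityNoisy
import Summits.AtomisticToContinuum.FouriersLaw.Theorems.VanishingNoiseTransferNoiseLocalityStubDuhamelFlipBound
import Summits.AtomisticToContinuum.FouriersLaw.Theorems.VanishingNoiseTransferNoiseLocalityStubFlipDissipationBound
import Summits.AtomisticToContinuum.FouriersLaw.Theorems.VanishingNoiseTransferNoiseLocalityStubNoisyPositive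
import Summits.AtomisticToContinuum.FouriersLaw.Theorems.OddSectorIrreversibilityCorrectorTheoryUniformMixing
import Summits.AtomisticToContinuum.FouriersLaw.Theorems.OddSectorIrreversibilityCorrectorResponseNonneg
import Literature.MathematicalPhysics.KineticTheory.VelocityFlipNoise

/-!
# `NoiseLocality` (stmt-AtomisticToContinuum-11975) REDUCED to C⁺ and X3 — part 1: glue and the derived floor

Helper file of line `relative-flip-energy-transfer` (lead `prover-line-stmt-AtomisticToContinuum-11975-0`), the importable record of
its kernel-checked skeleton `Cruxes/NoiseLocality/Lines/relative_flip_energy_transfer.lean` (v4): every FIXED-`N` stub of the line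
has landed (`Theorems.NoiseLocality.stub_responseDensityDet`, `…stub_responseDensityNoisy`, `…stub_duhamelFlipBound`,
`…stub_flipDissipationBound`, `…stub_noisyPositive`), so the crux
`Summit.AtomisticToContinuum.FouriersLaw.Theses.VanishingNoiseTransfer.NoiseLocality` (an `N`-uniform modulus
`|D_N(0) − D_N(ε)| ≤ w(ε)|D_N(0)||D_N(ε)|`) follows from exactly two inputs:

* C⁺ = `RelativeFlipEnergyBoundText` (the line's only open, `N`-uniform stub `stub_relativeFlipEnergyBound`, stated in tree
  vocabulary): `∃ A ∀ N`, for the unique deterministic steady family, any response density `U₀` and the response coefficient `D₀`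
  at `T`: `(N−1)·½Σ_i ∫ (U₀ − U₀∘Θ_i)² dμ_T ≤ A·D₀²`;
* X3 = the route's sibling crux `VanishingNoiseTransfer.NoisyFourier` (stmt-11977), used only at the rate `ε₀ = 1`.

`noiseLocality_of_relativeFlipEnergyBound : C⁺ → X3 → NoiseLocality` (conditional result; nothing here closes the item). Chain:
master inequality `|D_ε − D₀|² ≤ T² ε D_ε (N−1)𝓔_f(U₀)` (stubs 1a, 1b, 2, 3), the one-rate noisy floor from X3 at rate 1 + stub 5',
the DERIVED deterministic floor `1/D_N(0) ≤ 1/d₁ + T√(A⁺/d₁)` (`floor_of_relativeFlipEnergyBound`, using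
`response_nonneg_of_correctorTheory` + `CorrectorTheory_proof` for `D_N(0) ≥ 0`), and the division-free two-case algebra with the
explicit modulus `w(ε) = T√(2A⁺ε/d) + 4T²A⁺ε`. The five predicates `flipEnergy`, `IsResponseDensity`, `IsUniqueSteadyFamily`,
`IsUniqueFlipSteadyFamily`, `IsResponseCoeff` are verbatim copies of the skeleton's vocabulary (definitionally the unfolded texts of
the landed stubs). Numerics supporting C⁺: kit j014494 (Matthiessen slope N-independent, N ≤ 128, T = 1).
-/

noncomputable section

open MeasureTheory Filter Topology
open scoped ContDiff BigOperators

namespace Summit.AtomisticToContinuum.FouriersLaw.Theorems.NoiseLocality.Reduction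

open Literature.MathematicalPhysics.KineticTheory.HeatConduction

/-! ## Glue (real algebra and the per-`N` nonnegativity of deterministic responses) -/

/-- The flip Dirichlet energy `½ Σ_i ∫ (U − U∘Θ_i)² dμ` is nonnegative. [folklore] -/
theorem flipEnergy_nonneg {N : ℕ} (μ : Measure (PhaseSpace N)) (U : PhaseSpace N → ℝ) :
    0 ≤ (1 / 2) * ∑ i : Fin N, ∫ x, (U x - U (momentumFlip i x)) ^ 2 ∂μ := by
  refine mul_nonneg (by norm_num) (Finset.sum_nonneg fun i _ => ?_)
  exact integral_nonneg fun x => sq_nonneg _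

/-- THE MASTER INEQUALITY of the line (fixed `N`), from stubs 2 and 3:
`|D_ε − D₀| ≤ T √(ε · D_ε · (N−1) 𝓔_f(U₀))`, in the squared form used below. -/
theorem master_sq {T ε n Eε E0 D0 Dε : ℝ} (hε : 0 ≤ ε) (hn : 0 ≤ n) (hEε : 0 ≤ Eε) (hE0 : 0 ≤ E0)
    (h1 : |Dε - D0| ≤ ε * n * T ^ 2 * Real.sqrt Eε * Real.sqrt E0)
    (h2 : ε * n * T ^ 2 * Eε ≤ Dε) :
    |Dε - D0| ^ 2 ≤ T ^ 2 * (ε * Dε * (n * E0)) := by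
  have hc : 0 ≤ ε * n * T ^ 2 := mul_nonneg (mul_nonneg hε hn) (sq_nonneg T)
  have hsq : (ε * n * T ^ 2 * Real.sqrt Eε * Real.sqrt E0) ^ 2 =
      (ε * n * T ^ 2) * (ε * n * T ^ 2 * Eε) * E0 := by
    have e1 : Real.sqrt Eε ^ 2 = Eε := Real.sq_sqrt hEε
    have e2 : Real.sqrt E0 ^ 2 = E0 := Real.sq_sqrt hE0
    calc (ε * n * T ^ 2 * Real.sqrt Eε * Real.sqrt E0) ^ 2
        = (ε * n * T ^ 2) ^ 2 * Real.sqrt Eε ^ 2 * Real.sqrt E0 ^ 2 := by ring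
      _ = (ε * n * T ^ 2) ^ 2 * Eε * E0 := by rw [e1, e2]
      _ = (ε * n * T ^ 2) * (ε * n * T ^ 2 * Eε) * E0 := by ring
  have hrhs : 0 ≤ ε * n * T ^ 2 * Real.sqrt Eε * Real.sqrt E0 :=
    mul_nonneg (mul_nonneg hc (Real.sqrt_nonneg _)) (Real.sqrt_nonneg _)
  calc |Dε - D0| ^ 2 ≤ (ε * n * T ^ 2 * Real.sqrt Eε * Real.sqrt E0) ^ 2 := by
        have h0 : 0 ≤ |Dε - D0| := abs_nonneg _
        nlinarith [mul_nonneg h0 (sub_nonneg.2 h1), mul_nonneg hrhs (sub_nonneg.2 h1)]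
    _ = (ε * n * T ^ 2) * (ε * n * T ^ 2 * Eε) * E0 := hsq
    _ ≤ (ε * n * T ^ 2) * Dε * E0 :=
        mul_le_mul_of_nonneg_right (mul_le_mul_of_nonneg_left h2 hc) hE0
    _ = T ^ 2 * (ε * Dε * (n * E0)) := by ring

/-- DIVISION-FREE ALGEBRA of the line (the card's `divisionFree_of_master`): the squared master inequality,
the relative flip-energy bound `n 𝓔_f(U₀) ≤ A D₀²` (`A ≥ 0`) and a floor `0 < d ≤ D₀` give the crux shape
with `w = T √(2Aε/d) + 4T²Aε`. -/
theorem divisionFree_of_master {T ε A d n E0 D0 Dε : ℝ} (hT : 0 < T) (hε : 0 < ε) (hA : 0 ≤ A)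
    (hd : 0 < d) (hdD : d ≤ D0) (hDε : 0 ≤ Dε)
    (key : |Dε - D0| ^ 2 ≤ T ^ 2 * (ε * Dε * (n * E0)))
    (hC : n * E0 ≤ A * D0 ^ 2) :
    |D0 - Dε| ≤ (T * Real.sqrt (2 * A * ε / d) + 4 * T ^ 2 * A * ε) * |D0| * |Dε| := by
  have hD0 : 0 < D0 := hd.trans_le hdD
  rw [abs_of_pos hD0, abs_of_nonneg hDε]
  -- |D0 - Dε|² ≤ T² D0² (ε A Dε)
  have key' : |D0 - Dε| ^ 2 ≤ T ^ 2 * D0 ^ 2 * (ε * A * Dε) := by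
    have hk : 0 ≤ ε * Dε := mul_nonneg hε.le hDε
    calc |D0 - Dε| ^ 2 = |Dε - D0| ^ 2 := by rw [abs_sub_comm]
      _ ≤ T ^ 2 * (ε * Dε * (n * E0)) := key
      _ ≤ T ^ 2 * (ε * Dε * (A * D0 ^ 2)) :=
          mul_le_mul_of_nonneg_left (mul_le_mul_of_nonneg_left hC hk) (sq_nonneg T)
      _ = T ^ 2 * D0 ^ 2 * (ε * A * Dε) := by ring
  have hs_nonneg : 0 ≤ T * Real.sqrt (2 * A * ε / d) := mul_nonneg hT.le (Real.sqrt_nonneg _)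
  have h4_nonneg : 0 ≤ 4 * T ^ 2 * A * ε := by positivity
  rcases le_or_gt (D0 / 2) Dε with hcase | hcase
  · -- noise did not (much) hurt: Dε ≥ D0/2 ≥ d/2, Hölder-½ branch
    have hDεpos : 0 < Dε := by linarith
    have hfirst : |D0 - Dε| ≤ T * Real.sqrt (2 * A * ε / d) * D0 * Dε := by
      apply abs_le_of_sq_le_sq _ (by positivity)
      have e : (T * Real.sqrt (2 * A * ε / d) * D0 * Dε) ^ 2 =
          T ^ 2 * D0 ^ 2 * ((2 * A * ε / d) * Dε ^ 2) := by
        have : Real.sqrt (2 * A * ε / d) ^ 2 = 2 * A * ε / d := Real.sq_sqrt (by positivity)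
        calc (T * Real.sqrt (2 * A * ε / d) * D0 * Dε) ^ 2
            = T ^ 2 * Real.sqrt (2 * A * ε / d) ^ 2 * D0 ^ 2 * Dε ^ 2 := by ring
          _ = T ^ 2 * (2 * A * ε / d) * D0 ^ 2 * Dε ^ 2 := by rw [this]
          _ = T ^ 2 * D0 ^ 2 * ((2 * A * ε / d) * Dε ^ 2) := by ring
      rw [e]
      have h2d : 1 ≤ 2 * Dε / d := by
        rw [le_div_iff₀ hd]; linarith
      calc (D0 - Dε) ^ 2 = |D0 - Dε| ^ 2 := (sq_abs _).symm
        _ ≤ T ^ 2 * D0 ^ 2 * (ε * A * Dε) := key'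
        _ ≤ T ^ 2 * D0 ^ 2 * ((2 * A * ε / d) * Dε ^ 2) := by
            apply mul_le_mul_of_nonneg_left _ (by positivity)
            calc ε * A * Dε = ε * A * Dε * 1 := by ring
              _ ≤ ε * A * Dε * (2 * Dε / d) := mul_le_mul_of_nonneg_left h2d (by positivity)
              _ = 2 * A * ε / d * Dε ^ 2 := by ring
    calc |D0 - Dε| ≤ T * Real.sqrt (2 * A * ε / d) * D0 * Dε := hfirst
      _ ≤ (T * Real.sqrt (2 * A * ε / d) + 4 * T ^ 2 * A * ε) * D0 * Dε :=
          mul_le_mul_of_nonneg_right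
            (mul_le_mul_of_nonneg_right (le_add_of_nonneg_right h4_nonneg) hD0.le) hDε
  · -- noise hurt a lot: Dε < D0/2 forces Dε > 1/(4T²Aε), linear branch
    have hpos : 0 < D0 - Dε := by linarith
    have hq : D0 ^ 2 * (1 / 4) ≤ D0 ^ 2 * (T ^ 2 * (ε * A * Dε)) := by
      have hle : D0 / 2 ≤ D0 - Dε := by linarith
      calc D0 ^ 2 * (1 / 4) = (D0 / 2) ^ 2 := by ring
        _ ≤ (D0 - Dε) ^ 2 := by
            have h0 : 0 ≤ D0 / 2 := by linarith
            nlinarith [mul_nonneg h0 (sub_nonneg.2 hle), mul_nonneg (h0.trans hle) (sub_nonneg.2 hle)]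
        _ = |D0 - Dε| ^ 2 := (sq_abs _).symm
        _ ≤ T ^ 2 * D0 ^ 2 * (ε * A * Dε) := key'
        _ = D0 ^ 2 * (T ^ 2 * (ε * A * Dε)) := by ring
    have h4 : 1 ≤ 4 * T ^ 2 * A * ε * Dε := by
      have hq' := le_of_mul_le_mul_left hq (by positivity : 0 < D0 ^ 2)
      linarith
    calc |D0 - Dε| = D0 - Dε := abs_of_pos hpos
      _ ≤ D0 * 1 := by linarith
      _ ≤ D0 * (4 * T ^ 2 * A * ε * Dε) := mul_le_mul_of_nonneg_left h4 hD0.le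
      _ = (4 * T ^ 2 * A * ε) * D0 * Dε := by ring
      _ ≤ (T * Real.sqrt (2 * A * ε / d) + 4 * T ^ 2 * A * ε) * D0 * Dε :=
          mul_le_mul_of_nonneg_right
            (mul_le_mul_of_nonneg_right (le_add_of_nonneg_left hs_nonneg) hD0.le) hDε


/-- **Deterministic responses are nonnegative** (per-`N` form): for the unique weak steady family `μ0` of the `N`-chain
and its response coefficient `D0` at `T > 0`, `0 ≤ D0` — the tap energy identity of the Kubo corrector
(`response_nonneg_of_correctorTheory` with the landed `CorrectorTheory_proof`, stmt-14071, and `NessUnique_holds`,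
stmt-0741), transported from a global reference family to the per-`N` unique family by uniqueness near `δ = 0`. [folklore] -/
theorem responseCoeff_nonneg {ω₂ lam β γ : ℝ} (hω : 0 < ω₂) (hl : 0 < lam) (hβ : 0 < β) (hγ : 0 < γ)
    {T : ℝ} (hT : 0 < T) {N : ℕ} {μ0 : ℝ → ℝ → Measure (PhaseSpace N)}
    (hμ0 : (∀ T_L T_R : ℝ, 0 < T_L → 0 < T_R → (pinnedChain ω₂ lam β γ).IsSteadyState N T_L T_R (μ0 T_L T_R) ∧ ∀ ν : Measure (PhaseSpace N), (pinnedChain ω₂ lam β γ).IsSteadyState N T_L T_R ν → ν = μ0 T_L T_R)) {D0 : ℝ}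
    (hD0 : Tendsto (fun δ : ℝ => (pinnedChain ω₂ lam β γ).totalCurrent (μ0 (T + δ / 2) (T - δ / 2)) / δ) (𝓝[≠] 0) (𝓝 D0)) : 0 ≤ D0 := by
  set P := pinnedChain ω₂ lam β γ with hP
  have huniq : ∀ (M : ℕ) (T_L T_R : ℝ), 0 < T_L → 0 < T_R →
      ∀ μ ν : Measure (PhaseSpace M), P.IsSteadyState M T_L T_R μ → P.IsSteadyState M T_L T_R ν → μ = ν :=
    Summit.AtomisticToContinuum.FouriersLaw.Theses.VanishingNoiseTransfer.NessUnique_holds ω₂ lam β γ hω hl hβ hγ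
  -- a global reference steady family (by choice)
  let μref : (M : ℕ) → ℝ → ℝ → Measure (PhaseSpace M) := fun M T_L T_R =>
    if h : 0 < T_L ∧ 0 < T_R then
      Classical.choose (pinnedChain_exists_isSteadyState hω hl hβ hγ M h.1 h.2) else 0
  have hsteady : ∀ (M : ℕ) (T_L T_R : ℝ), 0 < T_L → 0 < T_R → P.IsSteadyState M T_L T_R (μref M T_L T_R) := by
    intro M T_L T_R hL hR
    have h : 0 < T_L ∧ 0 < T_R := ⟨hL, hR⟩
    simp only [μref, dif_pos h]
    exact Classical.choose_spec (pinnedChain_exists_isSteadyState hω hl hβ hγ M h.1 h.2)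
  -- `μ0` agrees with `μref N` near `δ = 0`
  have heq : ∀ T_L T_R : ℝ, 0 < T_L → 0 < T_R → μ0 T_L T_R = μref N T_L T_R := fun T_L T_R hL hR =>
    ((hμ0 T_L T_R hL hR).2 (μref N T_L T_R) (hsteady N T_L T_R hL hR)).symm
  have hev : (fun δ : ℝ => P.totalCurrent (μ0 (T + δ / 2) (T - δ / 2)) / δ) =ᶠ[𝓝[≠] 0]
      (fun δ : ℝ => P.totalCurrent (μref N (T + δ / 2) (T - δ / 2)) / δ) := by
    have hball : ∀ᶠ δ : ℝ in 𝓝 (0 : ℝ), |δ| < T := by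
      have : Metric.ball (0 : ℝ) T ∈ 𝓝 (0 : ℝ) := Metric.ball_mem_nhds 0 hT
      filter_upwards [this] with δ hδ
      simpa [Real.dist_eq] using hδ
    filter_upwards [nhdsWithin_le_nhds hball] with δ hδ
    have h1 : 0 < T + δ / 2 := by linarith [abs_lt.mp hδ]
    have h2 : 0 < T - δ / 2 := by linarith [abs_lt.mp hδ]
    rw [heq _ _ h1 h2]
  have hD0' : Tendsto (fun δ : ℝ => P.totalCurrent (μref N (T + δ / 2) (T - δ / 2)) / δ) (𝓝[≠] 0) (𝓝 D0) :=
    (hD0 : Tendsto (fun δ : ℝ => P.totalCurrent (μ0 (T + δ / 2) (T - δ / 2)) / δ) (𝓝[≠] 0) (𝓝 D0)).congr' hev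
  exact Summit.AtomisticToContinuum.FouriersLaw.Theorems.response_nonneg_of_correctorTheory
    Summit.AtomisticToContinuum.FouriersLaw.Theorems.OddSectorIrreversibility.Corrector.CorrectorTheory_proof
    hω hl hβ hγ huniq μref hsteady hT N hD0'

/-- The explicit modulus of the line tends to `0` at `0⁺` (indeed it is continuous with `w 0 = 0`). -/
theorem tendsto_modulus (T A d : ℝ) :
    Tendsto (fun ε : ℝ => T * Real.sqrt (2 * A * ε / d) + 4 * T ^ 2 * A * ε) (𝓝[>] 0) (𝓝 0) := by
  have hcont : Continuous fun ε : ℝ => T * Real.sqrt (2 * A * ε / d) + 4 * T ^ 2 * A * ε :=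
    (continuous_const.mul (Real.continuous_sqrt.comp (by fun_prop))).add (by fun_prop)
  have h := hcont.tendsto 0
  simp only [mul_zero, zero_div, Real.sqrt_zero, add_zero] at h
  exact h.mono_left nhdsWithin_le_nhds

/-! ## The deterministic floor, derived from X3 at rate 1 -/

/-- **The deterministic conductance floor, DERIVED** from C⁺ and X3: given the relative flip-energy bound (hypothesis `hC`, the
line's open stub) and `NoisyFourier` (X3) at the single rate `ε₀ = 1` — unique rate-1 flip-steady families with responses
`D_N(1) → κ₁(T) > 0`, hence with the landed fixed-`N` positivity `stub_noisyPositive` a one-rate floor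
`d₁ = min(κ₁/2, min_{2≤N<N₁} D_N(1)) > 0` — the squared master inequality at rate 1 (landed stubs 1a, 1b, 2, 3) gives
`1/D_N(0) ≤ 1/D_N(1) + T√(A⁺/D_N(1)) ≤ 1/d₁ + T√(A⁺/d₁)` for every `N ≥ 2`, i.e. an `N`-uniform floor `d ≤ D_N(0)` for the
unique deterministic steady family (`D_N(0) ≥ 0` by `responseCoeff_nonneg`). [folklore] -/
theorem floor_of_relativeFlipEnergyBound (hC : ∀ ω₂ lam β γ : ℝ, 0 < ω₂ → 0 < lam → 0 < β → 0 < γ → ∀ T : ℝ, 0 < T → ∃ A : ℝ, ∀ (N : ℕ)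
    (μ0 : ℝ → ℝ → MeasureTheory.Measure (Literature.MathematicalPhysics.KineticTheory.HeatConduction.PhaseSpace N)),
    (∀ T_L T_R : ℝ, 0 < T_L → 0 < T_R →
      (Literature.MathematicalPhysics.KineticTheory.HeatConduction.pinnedChain ω₂ lam β γ).IsSteadyState N T_L T_R
          (μ0 T_L T_R) ∧
        ∀ ν : MeasureTheory.Measure (Literature.MathematicalPhysics.KineticTheory.HeatConduction.PhaseSpace N),
          (Literature.MathematicalPhysics.KineticTheory.HeatConduction.pinnedChain ω₂ lam β γ).IsSteadyState N T_L T_R ν →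
            ν = μ0 T_L T_R) →
    ∀ U0 : Literature.MathematicalPhysics.KineticTheory.HeatConduction.PhaseSpace N → ℝ,
    (MeasureTheory.MemLp U0 2
          ((Literature.MathematicalPhysics.KineticTheory.HeatConduction.pinnedChain ω₂ lam β γ).gibbsMeasure N T) ∧
        (∀ g : Literature.MathematicalPhysics.KineticTheory.HeatConduction.PhaseSpace N → ℝ,
          ContDiff ℝ ((⊤ : ℕ∞) : WithTop ℕ∞) g → HasCompactSupport g →
            HasDerivAt (fun δ : ℝ => ∫ x, g x ∂(μ0 (T + δ / 2) (T - δ / 2)))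
              (∫ x, g x * U0 x
                ∂((Literature.MathematicalPhysics.KineticTheory.HeatConduction.pinnedChain ω₂ lam β γ).gibbsMeasure N T))
              0) ∧
        HasDerivAt (fun δ : ℝ =>
            (Literature.MathematicalPhysics.KineticTheory.HeatConduction.pinnedChain ω₂ lam β γ).totalCurrent
              (μ0 (T + δ / 2) (T - δ / 2)))
          (∑ i : Fin N, ∫ x,
            (Literature.MathematicalPhysics.KineticTheory.HeatConduction.pinnedChain ω₂ lam β γ).bondCurrent N i x * U0 x
              ∂((Literature.MathematicalPhysics.KineticTheory.HeatConduction.pinnedChain ω₂ lam β γ).gibbsMeasure N T))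
          0) →
    ∀ D0 : ℝ,
    Filter.Tendsto (fun δ : ℝ =>
        (Literature.MathematicalPhysics.KineticTheory.HeatConduction.pinnedChain ω₂ lam β γ).totalCurrent
          (μ0 (T + δ / 2) (T - δ / 2)) / δ) (nhdsWithin 0 {(0 : ℝ)}ᶜ) (nhds D0) →
    ((N : ℝ) - 1) *
        ((1 / 2) * ∑ i : Fin N, ∫ x,
          (U0 x - U0 (Literature.MathematicalPhysics.KineticTheory.HeatConduction.momentumFlip i x)) ^ 2
            ∂((Literature.MathematicalPhysics.KineticTheory.HeatConduction.pinnedChain ω₂ lam β γ).gibbsMeasure N T)) ≤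
      A * D0 ^ 2)
    (hNF : Summit.AtomisticToContinuum.FouriersLaw.Theses.VanishingNoiseTransfer.NoisyFourier) :
    ∀ ω₂ lam β γ : ℝ, 0 < ω₂ → 0 < lam → 0 < β → 0 < γ → ∀ T : ℝ, 0 < T → ∃ d : ℝ, 0 < d ∧
      ∀ N : ℕ, 2 ≤ N → ∀ μ0 : ℝ → ℝ → Measure (PhaseSpace N),
        (∀ T_L T_R : ℝ, 0 < T_L → 0 < T_R → (pinnedChain ω₂ lam β γ).IsSteadyState N T_L T_R (μ0 T_L T_R) ∧ ∀ ν : Measure (PhaseSpace N), (pinnedChain ω₂ lam β γ).IsSteadyState N T_L T_R ν → ν = μ0 T_L T_R) →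
          ∀ D0 : ℝ, Tendsto (fun δ : ℝ => (pinnedChain ω₂ lam β γ).totalCurrent (μ0 (T + δ / 2) (T - δ / 2)) / δ) (𝓝[≠] 0) (𝓝 D0) → d ≤ D0 := by
  intro ω₂ lam β γ hω hl hβ hγ T hT
  set P := pinnedChain ω₂ lam β γ with hP_def
  obtain ⟨A, hA⟩ := hC ω₂ lam β γ hω hl hβ hγ T hT
  set A' : ℝ := max A 0 with hA'def
  have hA'0 : 0 ≤ A' := le_max_right _ _
  -- X3 at rate 1
  obtain ⟨hexu, κ, hκpos, hresp⟩ := hNF ω₂ lam β γ hω hl hβ hγ _ rfl 1 one_pos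
  -- the unique rate-1 flip-steady families, by choice
  have famChoice : ∃ fam : (N : ℕ) → ℝ → ℝ → Measure (PhaseSpace N),
      ∀ (N : ℕ) (T_L T_R : ℝ), 0 < T_L → 0 < T_R →
        P.IsFlipSteadyState N T_L T_R 1 (fam N T_L T_R) ∧
          ∀ ν : Measure (PhaseSpace N), P.IsFlipSteadyState N T_L T_R 1 ν → ν = fam N T_L T_R := by
    classical
    refine ⟨fun N T_L T_R => if h : 0 < T_L ∧ 0 < T_R then (hexu N T_L T_R h.1 h.2).choose else 0,
      fun N T_L T_R hL hR => ?_⟩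
    simp only [dif_pos (And.intro hL hR)]
    exact (hexu N T_L T_R hL hR).choose_spec
  obtain ⟨μ1, hμ1⟩ := famChoice
  obtain ⟨D1, hD1, hD1lim⟩ := hresp μ1 (fun N T_L T_R hL hR => (hμ1 N T_L T_R hL hR).1) T hT
  have hκT : 0 < κ T := hκpos T hT
  obtain ⟨N₁, hN₁⟩ := (hD1lim.eventually_const_lt (half_lt_self hκT)).exists_forall_of_atTop
  -- the one-rate noisy floor `d₁`
  have hposD1 : ∀ N : ℕ, 2 ≤ N → 0 < D1 N := by
    intro N hN
    have hμ1N : (∀ T_L T_R : ℝ, 0 < T_L → 0 < T_R → P.IsFlipSteadyState N T_L T_R 1 ((μ1 N) T_L T_R) ∧ ∀ ν : Measure (PhaseSpace N), P.IsFlipSteadyState N T_L T_R 1 ν → ν = (μ1 N) T_L T_R) := fun T_L T_R hL hR => hμ1 N T_L T_R hL hR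
    obtain ⟨U1, hU1⟩ := Summit.AtomisticToContinuum.FouriersLaw.Theorems.NoiseLocality.stub_responseDensityNoisy ω₂ lam β γ hω hl hβ hγ T hT N 1 one_pos (μ1 N) hμ1N
    exact Summit.AtomisticToContinuum.FouriersLaw.Theorems.NoiseLocality.stub_noisyPositive ω₂ lam β γ hω hl hβ hγ T hT N hN 1 one_pos (μ1 N) hμ1N U1 hU1 (D1 N) (hD1 N)
  have hfin : ∃ d₀ : ℝ, 0 < d₀ ∧ ∀ N ∈ Finset.Ico 2 N₁, d₀ ≤ D1 N := by
    by_cases hne : (Finset.Ico 2 N₁).Nonempty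
    · refine ⟨(Finset.Ico 2 N₁).inf' hne D1, ?_, fun N hN => Finset.inf'_le _ hN⟩
      obtain ⟨N, hN, hEq⟩ := Finset.exists_mem_eq_inf' hne D1
      rw [hEq]
      exact hposD1 N (Finset.mem_Ico.mp hN).1
    · exact ⟨1, one_pos, fun N hN => (hne ⟨N, hN⟩).elim⟩
  obtain ⟨d₀, hd₀, hd₀le⟩ := hfin
  set d₁ : ℝ := min (κ T / 2) d₀ with hd₁def
  have hd₁ : 0 < d₁ := lt_min (half_pos hκT) hd₀
  have hd₁le : ∀ N : ℕ, 2 ≤ N → d₁ ≤ D1 N := by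
    intro N hN
    rcases lt_or_ge N N₁ with h | h
    · exact (min_le_right _ _).trans (hd₀le N (Finset.mem_Ico.mpr ⟨hN, h⟩))
    · exact (min_le_left _ _).trans (hN₁ N h).le
  -- the deterministic floor
  have hsum : 0 < 1 / d₁ + T * Real.sqrt (A' / d₁) := by positivity
  refine ⟨(1 / d₁ + T * Real.sqrt (A' / d₁))⁻¹, inv_pos.mpr hsum, fun N hN μ0 hμ0 D0 hD0 => ?_⟩
  have hn : 0 ≤ (N : ℝ) - 1 := by
    have : (2 : ℝ) ≤ N := by exact_mod_cast hN
    linarith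
  -- master inequality at rate 1 between `μ0` and `μ1 N`
  have hμ1N : (∀ T_L T_R : ℝ, 0 < T_L → 0 < T_R → P.IsFlipSteadyState N T_L T_R 1 ((μ1 N) T_L T_R) ∧ ∀ ν : Measure (PhaseSpace N), P.IsFlipSteadyState N T_L T_R 1 ν → ν = (μ1 N) T_L T_R) := fun T_L T_R hL hR => hμ1 N T_L T_R hL hR
  have hD1N : Tendsto (fun δ : ℝ => P.totalCurrent ((μ1 N) (T + δ / 2) (T - δ / 2)) / δ) (𝓝[≠] 0) (𝓝 (D1 N)) := hD1 N
  obtain ⟨U0, hU0⟩ := Summit.AtomisticToContinuum.FouriersLaw.Theorems.NoiseLocality.stub_responseDensityDet ω₂ lam β γ hω hl hβ hγ T hT N μ0 hμ0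
  obtain ⟨U1, hU1⟩ := Summit.AtomisticToContinuum.FouriersLaw.Theorems.NoiseLocality.stub_responseDensityNoisy ω₂ lam β γ hω hl hβ hγ T hT N 1 one_pos (μ1 N) hμ1N
  have h1 := Summit.AtomisticToContinuum.FouriersLaw.Theorems.NoiseLocality.stub_duhamelFlipBound ω₂ lam β γ hω hl hβ hγ T hT N 1 one_pos μ0 (μ1 N) hμ0 hμ1N U0 U1 hU0 hU1 D0 (D1 N) hD0 hD1N
  have h2 := Summit.AtomisticToContinuum.FouriersLaw.Theorems.NoiseLocality.stub_flipDissipationBound ω₂ lam β γ hω hl hβ hγ T hT N 1 one_pos (μ1 N) hμ1N U1 hU1 (D1 N) hD1N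
  have h3 : ((N : ℝ) - 1) * ((1 / 2) * ∑ i : Fin N, ∫ x, (U0 x - U0 (momentumFlip i x)) ^ 2 ∂(P.gibbsMeasure N T)) ≤ A' * D0 ^ 2 :=
    (hA N μ0 hμ0 U0 hU0 D0 hD0).trans (mul_le_mul_of_nonneg_right (le_max_left A 0) (sq_nonneg D0))
  have hE0 := flipEnergy_nonneg (P.gibbsMeasure N T) U0
  have hE1 := flipEnergy_nonneg (P.gibbsMeasure N T) U1
  have key := master_sq zero_le_one hn hE1 hE0 h1 h2
  -- `|D1 N - D0|² ≤ T² D1 N A' D0²`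
  set Dn := D1 N with hDn
  have hDnpos : 0 < Dn := hd₁.trans_le (hd₁le N hN)
  have key' : |Dn - D0| ^ 2 ≤ (T * Real.sqrt (A' * Dn) * |D0|) ^ 2 := by
    have hsq : (T * Real.sqrt (A' * Dn) * |D0|) ^ 2 = T ^ 2 * (A' * Dn) * D0 ^ 2 := by
      rw [mul_pow, mul_pow, Real.sq_sqrt (by positivity), sq_abs]
    rw [hsq]
    calc |Dn - D0| ^ 2 ≤ T ^ 2 * (1 * Dn * (((N : ℝ) - 1) * ((1 / 2) * ∑ i : Fin N, ∫ x, (U0 x - U0 (momentumFlip i x)) ^ 2 ∂(P.gibbsMeasure N T)))) := key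
      _ ≤ T ^ 2 * (1 * Dn * (A' * D0 ^ 2)) := by gcongr
      _ = T ^ 2 * (A' * Dn) * D0 ^ 2 := by ring
  have hlin : Dn - D0 ≤ T * Real.sqrt (A' * Dn) * |D0| := by
    have hnn : 0 ≤ T * Real.sqrt (A' * Dn) * |D0| := by positivity
    exact (le_abs_self _).trans (abs_le_of_sq_le_sq' key' hnn).2
  -- hence `D0 > 0` (responses are nonnegative; `D0 = 0` would force `Dn ≤ 0`) and
  -- `1/D0 ≤ 1/Dn + T √(A'/Dn) ≤ 1/d₁ + T √(A'/d₁)`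
  have hD0nn : 0 ≤ D0 := responseCoeff_nonneg hω hl hβ hγ hT hμ0 hD0
  have hD0pos : 0 < D0 := by
    rcases hD0nn.lt_or_eq with h | h
    · exact h
    · exfalso
      rw [← h] at hlin
      simp only [sub_zero, abs_zero, mul_zero] at hlin
      linarith
  rw [abs_of_pos hD0pos] at hlin
  have hrec : D0⁻¹ ≤ Dn⁻¹ + T * Real.sqrt (A' / Dn) := by
    -- Dn ≤ D0 (1 + T √(A' Dn)) and √(A' Dn) = √(A'/Dn) Dn
    have h1' : Dn ≤ D0 * (1 + T * Real.sqrt (A' * Dn)) := by nlinarith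
    have hsqrt : Real.sqrt (A' * Dn) = Real.sqrt (A' / Dn) * Dn := by
      rw [show A' * Dn = (A' / Dn) * Dn ^ 2 by field_simp, Real.sqrt_mul (by positivity) (Dn ^ 2),
        Real.sqrt_sq hDnpos.le]
    rw [hsqrt] at h1'
    have hDn0 : Dn ≠ 0 := hDnpos.ne'
    have hX : 1 ≤ (Dn⁻¹ + T * Real.sqrt (A' / Dn)) * D0 := by
      have : (Dn⁻¹ + T * Real.sqrt (A' / Dn)) * D0 = (D0 * (1 + T * (Real.sqrt (A' / Dn) * Dn))) / Dn := by
        field_simp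
      rw [this, le_div_iff₀ hDnpos, one_mul]
      exact h1'
    calc D0⁻¹ = D0⁻¹ * 1 := (mul_one _).symm
      _ ≤ D0⁻¹ * ((Dn⁻¹ + T * Real.sqrt (A' / Dn)) * D0) := by gcongr
      _ = Dn⁻¹ + T * Real.sqrt (A' / Dn) := by field_simp
  have hmono : Dn⁻¹ + T * Real.sqrt (A' / Dn) ≤ 1 / d₁ + T * Real.sqrt (A' / d₁) := by
    have ha : Dn⁻¹ ≤ 1 / d₁ := by
      rw [one_div]; exact (inv_le_inv₀ hDnpos hd₁).2 (hd₁le N hN)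
    have hb : Real.sqrt (A' / Dn) ≤ Real.sqrt (A' / d₁) :=
      Real.sqrt_le_sqrt (div_le_div_of_nonneg_left hA'0 hd₁ (hd₁le N hN))
    gcongr
  have hfinal : D0⁻¹ ≤ 1 / d₁ + T * Real.sqrt (A' / d₁) := hrec.trans hmono
  exact (inv_le_inv₀ hD0pos (inv_pos.mpr hsum) |>.1 (by rwa [inv_inv]))

/-- Registered helper sub-goal `helper_floorOfRelativeFlipEnergyBound` of crux stmt-AtomisticToContinuum-11975 (line
`relative-flip-energy-transfer`) = `floor_of_relativeFlipEnergyBound` in registry form: C⁺ → X3 → the `N`-uniform deterministic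
conductance floor. [folklore] -/
theorem helper_floorOfRelativeFlipEnergyBound : (∀ ω₂ lam β γ : ℝ, 0 < ω₂ → 0 < lam → 0 < β → 0 < γ → ∀ T : ℝ, 0 < T → ∃ A : ℝ, ∀ (N : ℕ) (μ0 : ℝ → ℝ → MeasureTheory.Measure (Literature.MathematicalPhysics.KineticTheory.HeatConduction.PhaseSpace N)), (∀ T_L T_R : ℝ, 0 < T_L → 0 < T_R → (Literature.MathematicalPhysics.KineticTheory.HeatConduction.pinnedChain ω₂ lam β γ).IsSteadyState N T_L T_R (μ0 T_L T_R) ∧ ∀ ν : MeasureTheory.Measure (Literature.MathematicalPhysics.KineticTheory.HeatConduction.PhaseSpace N), (Literature.MathematicalPhysics.KineticTheory.HeatConduction.pinnedChain ω₂ lam β γ).IsSteadyState N T_L T_R ν → ν = μ0 T_L T_R) → ∀ U0 : Literature.MathematicalPhysics.KineticTheory.HeatConduction.PhaseSpace N → ℝ, (MeasureTheory.MemLp U0 2 ((Literature.MathematicalPhysics.KineticTheory.HeatConduction.pinnedChain ω₂ lam β γ).gibbsMeasure N T) ∧ (∀ g : Literature.MathematicalPhysics.KineticTheory.HeatConduction.PhaseSpace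 N → ℝ, ContDiff ℝ ((⊤ : ℕ∞) : WithTop ℕ∞) g → HasCompactSupport g → HasDerivAt (fun δ : ℝ => ∫ x, g x ∂(μ0 (T + δ / 2) (T - δ / 2))) (∫ x, g x * U0 x ∂((Literature.MathematicalPhysics.KineticTheory.HeatConduction.pinnedChain ω₂ lam β γ).gibbsMeasure N T)) 0) ∧ HasDerivAt (fun δ : ℝ => (Literature.MathematicalPhysics.KineticTheory.HeatConduction.pinnedChain ω₂ lam β γ).totalCurrent (μ0 (T + δ / 2) (T - δ / 2))) (∑ i : Fin N, ∫ x, (Literature.MathematicalPhysics.KineticTheory.HeatConduction.pinnedChain ω₂ lam β γ).bondCurrent N i x * U0 x ∂((Literature.MathematicalPhysics.KineticTheory.HeatConduction.pinnedChain ω₂ lam β γ).gibbsMeasure N T)) 0) → ∀ D0 : ℝ, Filter.Tendsto (fun δ : ℝ => (Literature.MathematicalPhysics.KineticTheory.HeatConduction.pinnedChain ω₂ lam β γ).totalCurrent (μ0 (T + δ / 2) (T - δ / 2)) / δ) (nhdsWithin 0 {(0 : ℝ)}ᶜ) (nhds D0) → ((N : ℝ) - 1) * ((1 / 2) * ∑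 i : Fin N, ∫ x, (U0 x - U0 (Literature.MathematicalPhysics.KineticTheory.HeatConduction.momentumFlip i x)) ^ 2 ∂((Literature.MathematicalPhysics.KineticTheory.HeatConduction.pinnedChain ω₂ lam β γ).gibbsMeasure N T)) ≤ A * D0 ^ 2) → Summit.AtomisticToContinuum.FouriersLaw.Theses.VanishingNoiseTransfer.NoisyFourier → ∀ ω₂ lam β γ : ℝ, 0 < ω₂ → 0 < lam → 0 < β → 0 < γ → ∀ T : ℝ, 0 < T → ∃ d : ℝ, 0 < d ∧ ∀ N : ℕ, 2 ≤ N → ∀ μ0 : ℝ → ℝ → Measure (PhaseSpace N), (∀ T_L T_R : ℝ, 0 < T_L → 0 < T_R → (pinnedChain ω₂ lam β γ).IsSteadyState N T_L T_R (μ0 T_L T_R) ∧ ∀ ν : Measure (PhaseSpace N), (pinnedChain ω₂ lam β γ).IsSteadyState N T_L T_R ν → ν = μ0 T_L T_R) → ∀ D0 : ℝ, Tendsto (fun δ : ℝ => (pinnedChain ω₂ lam β γ).totalCurrent (μ0 (T + δ / 2) (T - δ / 2)) / δ) (𝓝[≠] 0) (𝓝 D0) → d ≤ D0 :=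
  fun hC hNF => floor_of_relativeFlipEnergyBound hC hNF

end Summit.AtomisticToContinuum.FouriersLaw.Theorems.NoiseLocality.Reduction

end
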